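/-
Copyright (c) 2026 the pub-hodgecm-mathlib formalisation cell (harness21).  Prover seat hodgecm-mathlib-LH4-p11 (g9), req620 Track A «(D-RAM) FOUR-FRAME» squad, helper lane on
h413 = stmt-HodgeConjecture-24833 (count-neutral).  β-BOARD v1 (sub-dealer LH4-p05 (g8)) ROW R2 «G₃ PURE» — THE COMPOSITION OF RECORD: ★ p861290 (LH4-p10 (g6), the sum) ∘
★ p861341 (LH7-p06 (g0), the shell∕tube letters) ∘ ★ p861330 (this seat, the per-lattice read).  2026-09-04.
-/
import Summits.HodgeConjecture.HodgeConjecture.Theorems.F0P3cDyRamLabelledOddPureStrataG3        -- ★ p861290 (LH4-p10 (g6)): `finsum_stratum_G3_shell_labelledOdd_div_relIndex_eq` ∕ `…_eq_zero_of_not` with three ∀-binders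
import Summits.HodgeConjecture.HodgeConjecture.Theorems.F0P3cDyRamLabelledOddPureStrataG3Shell   -- ★ p861341 (LH7-p06 (g0)): `shell_iff_of_mem_stratum_G3`, `tube_of_mem_stratum_G3`
import Summits.HodgeConjecture.HodgeConjecture.Theorems.F0P3cDyRamLabelledOddPureLatticeG3      -- ★ p861330 (this seat): `labelledOddCount_div_relIndex_of_mem_stratum_G3`
import HarnessLib

/-!
# Crux `H413`, line LH4 «(D-RAM) FOUR-FRAME» — (β-BAL) Stage B, β-BOARD ROW R2 «G₃ PURE» OF RECORD: the glued stratum `G₃ = (2ρ+s, 2ρ+s, 2ρ)` on the clean shell in the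
# one-slot cell `2ρ + m* ≤ n₁`, ALL THREE BINDERS DISCHARGED — `Σᶠ_{M ∈ stratum G₃, shell} labelledOddCount σ ϖ 0 i Λ M ∕ [𝒰 : N(S̃′(M))]` in closed form

Cell `hodgecm-mathlib` (D-0151), FLOOR 0, crux item H413 = `stmt-HodgeConjecture-24833`, route `HCCMUnconditional`; squad F0∕P3c∕LH4.  THEOREMS ONLY (no `def`, no instance, no
notation, no `sorry`, default heartbeats); ★-only imports; lane `--supports stmt-HodgeConjecture-24833 --as helper` (count-neutral); pays NO row, states NO law.
WHAT.  ★ p861290 `finsum_stratum_G3_shell_labelledOdd_div_relIndex_eq` (LH4-p10 (g6)) proves the G₃ row of LH4-p05 (g8)'s β-BOARD modulo three ∀-hypotheses on the stratum: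
the clean-shell read `hshell`, the tube letters `htube`, and the per-lattice value `hval`.  All three are now ★: `hshell` ∕ `htube` = ★ p861341 `shell_iff_of_mem_stratum_G3` ∕
`tube_of_mem_stratum_G3` (LH7-p06 (g0); letters string-equal, LHref-N #623), `hval` = ★ p861330 `labelledOddCount_div_relIndex_of_mem_stratum_G3` (this seat) behind the shell read.
This file is the 2-theorem COMPOSITION: the row `…_eq_ofRecord` with the remaining letters `(hD) (h2) (h2d) (hE) (hN₀) (hmc) (T hT) (ρ s) (hρ hs) (hcell) (hσeC heC1 heC) (i)` only —
the `hP2G3` cell part of F0P3a-p01 (g37)'s (T2) trunk ★ `…LabelledOddStageBTable.hbox_of_oddBoxSum` as ONE name — and its token-free zero twin `…_eq_zero_of_not_ofRecord`.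
VALUE (VERDICT-G3row v1 §2 = ★ p861290's RHS): `[2ρ + s + ℓ₀ = n₃ ∧ 2 ∣ s ∧ 2ρ ≤ min n₁ n₂] · ω(e_C)∕2 · (ω(−1)(q−1)q^{2ρ+s∕2−1}, q^{2ρ+s∕2−1}((q−1)[2d ≤ s] − [s+2 = 2d]), 0)_i`.
HONEST LABEL: count-neutral composition; the ε-boundary layers `2ρ + m* > n₁` (row R5), the table identity, (β-BAL), (β) `stub_law_cleanSgn`, T₊ remain OPEN; `HC_CM` is proved only
modulo the 7 printed citations (2 remaining named inputs: hLiu418 = `stmt-HodgeConjecture-24832`, h413 = `stmt-HodgeConjecture-24833`) until rung 0 closes.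
References: [Kottwitz1986BaseChangeUnits] §1 pp. 240–241 · [Rogawski1990] §4.9 Prop. 4.9.1 (a)(b) p. 55, §4.10 p. 58 · [LanglandsShelstad1987] §3 · [Serre1979] Ch. V §3 Cor. 3.
-/

set_option autoImplicit false

noncomputable section

namespace Summit.HodgeConjecture.HodgeConjecture.Cruxes.H413.F0P3cDyRamLabelledOddPureStrataG3OfRecord

open Literature.NumberTheory.Automorphic Literature.NumberTheory.Automorphic.HermitianLattice
open Literature.NumberTheory.Automorphic.UnitaryLatticeTree Literature.NumberTheory.Automorphic.UnitaryThreeFourFrame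
open Literature.NumberTheory.LocalFields Literature.NumberTheory.LocalFields.WildQuadraticDatum
open Summit.HodgeConjecture.HodgeConjecture.Cruxes.H413.F0P3cDyRamFourFramePieces
open Summit.HodgeConjecture.HodgeConjecture.Cruxes.H413.F0P3cDyRamFourFrameCensusDefs
open Summit.HodgeConjecture.HodgeConjecture.Cruxes.H413.F0P3cDyRamStageOneBDefs (mcOfRecord)
open Summit.HodgeConjecture.HodgeConjecture.Cruxes.H413.F0P3cDyRamDiagonalTorusDefs
open Summit.HodgeConjecture.HodgeConjecture.Cruxes.H413.F0P3cDyRamDiagonalStrataDefs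
open Summit.HodgeConjecture.HodgeConjecture.Cruxes.H413.F0P3cDyRamDiagonalKappaCountDefs
open Summit.HodgeConjecture.HodgeConjecture.Cruxes.H413.F0P3cDyRamLabelledOddCountDefs
open Summit.HodgeConjecture.HodgeConjecture.Cruxes.H413.F0P3cDyRamLabelledOddPureStrataG3
open Summit.HodgeConjecture.HodgeConjecture.Cruxes.H413.F0P3cDyRamLabelledOddPureStrataG3Shell (shell_iff_of_mem_stratum_G3 tube_of_mem_stratum_G3)
open Summit.HodgeConjecture.HodgeConjecture.Cruxes.H413.F0P3cDyRamLabelledOddPureLatticeG3 (labelledOddCount_div_relIndex_of_mem_stratum_G3)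
open scoped Valued WithZero Matrix MatrixGroups

variable {K : Type} [Field K] [Valued K ℤᵐ⁰] [CompleteSpace K] [Fintype 𝓀[K]] {σ : K →+* K} {ϖ : K} {d t : ℕ} {α β : K} {N₀ n₁ n₂ n₃ : ℕ}

omit [CompleteSpace K] [Fintype 𝓀[K]] in
/-- **`G₃` OFF THE READ, TOKEN-FREE, OF RECORD**: in the one-slot cell `2ρ + m* ≤ n₁` (`ρ, s ≥ 1`, `mcOfRecord d ≤ N₀`), if `¬ (2ρ + s + ℓ₀ = n₃ ∧ 2 ∣ s ∧ 2ρ ≤ min n₁ n₂)` the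
clean-shell cut of the stratum `(2ρ+s, 2ρ+s, 2ρ)` carries `Σᶠ labelledOddCount σ ϖ 0 i Λ M ∕ w M = 0` for ANY label `Λ` and weight `w` (★ p861290's zero twin with `hshell` ∕ `htube` :=
★ p861341). [cite: Kottwitz1986BaseChangeUnits, §1 pp. 240–241] [cite: Rogawski1990, §4.9 Prop. 4.9.1 (a) p. 55] -/
theorem finsum_stratum_G3_shell_eq_zero_of_not_ofRecord (hD : IsRamifiedQuadraticDatum σ ϖ d t)
    (hE : IsElementDatum σ ϖ N₀ α β n₁ n₂ n₃) (hmc : mcOfRecord d ≤ N₀)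
    (T : GL (Fin 3) K) (ρ s : ℕ) (hρ : 1 ≤ ρ) (hs : 1 ≤ s) (hcell : 2 * ρ + mstarOfRecord d ≤ n₁)
    (Λ : Submodule 𝒪[K] (Fin 3 → K) → (Fin 3 → K) → Prop) (w : Submodule 𝒪[K] (Fin 3 → K) → ℚ)
    (hnot : ¬ (2 * ρ + s + d % 2 = n₃ ∧ 2 ∣ s ∧ 2 * ρ ≤ min n₁ n₂)) (i : Fin 3) :
    ∑ᶠ M ∈ {M : Submodule 𝒪[K] (Fin 3 → K) | M ∈ stratum σ ϖ T ![2 * ρ + s, 2 * ρ + s, 2 * ρ] ∧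
        (LatticeInLevel ϖ (d % 2) (Matrix.diagonal ![α - 1, β - 1, 0]) M ∧ ¬ LatticeInLevel ϖ (d % 2 + 1) (Matrix.diagonal ![α - 1, β - 1, 0]) M ∧
          LatticeInLevel ϖ (mcOfRecord d) (Matrix.diagonal ![(α - 1) * (α - 1), (β - 1) * (β - 1), 0]) M)},
      (labelledOddCount σ ϖ 0 i Λ M : ℚ) / w M = 0 :=
  finsum_stratum_G3_shell_eq_zero_of_not T ρ s Λ w (shell_iff_of_mem_stratum_G3 hD hE hmc T ρ s hρ hs hcell) (tube_of_mem_stratum_G3 hD hE T ρ s hρ hs hcell) hnot i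

/-- **THE `G₃ = (2ρ+s, 2ρ+s, 2ρ)` ROW OF RECORD, ONE-SLOT CELL `2ρ + m* ≤ n₁`** (`ρ, s ≥ 1`; `2 ≤ d ≤ N₀`, `mcOfRecord d ≤ N₀`, `|2| < 1`; `e_C` the tower-sign token of `β − α`
at exponent `(n₃ − ℓ₀)∕2`):
`Σᶠ_{M ∈ stratum G₃, shell} labelledOddCount σ ϖ 0 i Λ M ∕ [𝒰 : N(S̃′(M))] = [2ρ + s + ℓ₀ = n₃ ∧ 2 ∣ s ∧ 2ρ ≤ min n₁ n₂] · ω(e_C)∕2 ·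
(ω(−1)·(q−1)·q^{2ρ+s∕2−1}, q^{2ρ+s∕2−1}·((q−1)·[2d ≤ s] − [s+2 = 2d]), 0)_i` — ★ p861290 (LH4-p10 (g6)) with `hshell` ∕ `htube` := ★ p861341 (LH7-p06 (g0)) and `hval` := ★ p861330 (this seat)
behind the shell read.  The `hP2G3` cell letter of the (T2) trunk as one name. [cite: Kottwitz1986BaseChangeUnits, §1 pp. 240–241] [cite: Rogawski1990, §4.9 Prop. 4.9.1 (a)(b) p. 55, §4.10 p. 58]
[cite: LanglandsShelstad1987, §3] [cite: Serre1979, Ch. V §3 Cor. 3] -/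
theorem finsum_stratum_G3_shell_labelledOdd_div_relIndex_eq_ofRecord (hD : IsRamifiedQuadraticDatum σ ϖ d t) (h2 : Valued.v (2 : K) < 1) (h2d : 2 ≤ d)
    (hE : IsElementDatum σ ϖ N₀ α β n₁ n₂ n₃) (hN₀ : d ≤ N₀) (hmc : mcOfRecord d ≤ N₀)
    (T : GL (Fin 3) K) (hT : (T : Matrix (Fin 3) (Fin 3) K) = Matrix.diagonal ![α, β, 1]) (ρ s : ℕ) (hρ : 1 ≤ ρ) (hs : 1 ≤ s)
    (hcell : 2 * ρ + mstarOfRecord d ≤ n₁)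
    {eC : K} (hσeC : σ eC = eC) (heC1 : Valued.v eC = 1)
    (heC : Valued.v ((ϖ ^ mstarOfRecord d)⁻¹ * ((β - α) * ((ϖ * σ ϖ) ^ ((n₃ - d % 2) / 2))⁻¹ - eC * ((ϖ - σ ϖ) * ((ϖ * σ ϖ) ^ ((d - d % 2) / 2))⁻¹))) ≤ 1)
    (i : Fin 3) :
    ∑ᶠ M ∈ {M : Submodule 𝒪[K] (Fin 3 → K) | M ∈ stratum σ ϖ T ![2 * ρ + s, 2 * ρ + s, 2 * ρ] ∧
        (LatticeInLevel ϖ (d % 2) (Matrix.diagonal ![α - 1, β - 1, 0]) M ∧ ¬ LatticeInLevel ϖ (d % 2 + 1) (Matrix.diagonal ![α - 1, β - 1, 0]) M ∧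
          LatticeInLevel ϖ (mcOfRecord d) (Matrix.diagonal ![(α - 1) * (α - 1), (β - 1) * (β - 1), 0]) M)},
      (labelledOddCount σ ϖ 0 i (valueClassLabel σ ϖ (α - 1) (β - 1) (mstarOfRecord d) d) M : ℚ) /
        ((((unitStabilizer M).map (unitNormMap σ 3)).relIndex (fixedUnitTorus σ 3) : ℕ) : ℚ) =
      if 2 * ρ + s + d % 2 = n₃ ∧ 2 ∣ s ∧ 2 * ρ ≤ min n₁ n₂ then
        (normSign σ eC : ℚ) / 2 *
          (![(normSign σ (-1 : K) : ℚ) * ((Fintype.card 𝓀[K] : ℚ) - 1) * (Fintype.card 𝓀[K] : ℚ) ^ (2 * ρ + s / 2 - 1),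
              (Fintype.card 𝓀[K] : ℚ) ^ (2 * ρ + s / 2 - 1) * ((if 2 * d ≤ s then (Fintype.card 𝓀[K] : ℚ) - 1 else 0) - (if s + 2 = 2 * d then 1 else 0)),
              (0 : ℚ)] : Fin 3 → ℚ) i
      else 0 := by
  have hshell := shell_iff_of_mem_stratum_G3 hD hE hmc T ρ s hρ hs hcell
  refine finsum_stratum_G3_shell_labelledOdd_div_relIndex_eq hD h2 hE hN₀ T hT ρ s hρ hs hcell hshell (tube_of_mem_stratum_G3 hD hE T ρ s hρ hs hcell) i ?_
  intro M hM hsh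
  exact labelledOddCount_div_relIndex_of_mem_stratum_G3 hD h2d hE hmc T hT hρ hs hcell ((hshell M hM).1 hsh) hM hsh.1 hsh.2.1 hsh.2.2 hσeC heC1 heC i

end Summit.HodgeConjecture.HodgeConjecture.Cruxes.H413.F0P3cDyRamLabelledOddPureStrataG3OfRecord

end
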